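import Summits.HodgeConjecture.HodgeConjecture.Theorems.F0D9opRoad2Mod            -- LETTER `RecordTameLevelQuotientModel` (ED. 6, door P″; imports the Body)
import Literature.AlgebraicGeometry.ShimuraVarieties.UnitaryShimuraCurveLevelQuotientAction    -- ★ p844619 A-p03 (g27): `RecordSystemGS.exists_levelQuotientAction_of_model` (+ the five §1 organs), cited BY NAME
import Literature.AlgebraicGeometry.Motives.IntegralModelTameQuotientSmoothProper            -- ★ A-p14 (g30): `IntegralModel.exists_tameQuotient_isSmoothProper_one` (+ `genericIso'`)
import Literature.AlgebraicGeometry.Motives.VarietiesProperProofs                          -- ★ `IsProjectiveOver.isProper`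
import HarnessLib

/-!
# `F0P6qTameLevelQuotient` — ★ RE-HOME (rung-0 re-homing task, books INVENTORY §8.4 M-3; LEAD F0P6-plan (g4) «M-72») of the crux workfile `Lines/F0_P6q_TameLevelQuotient.lean`

This `Theorems/` module is the TREE BYTES of `Summits/HodgeConjecture/HodgeConjecture/Cruxes/HLiu418/Lines/F0_P6q_TameLevelQuotient.lean` (edition of record,
tree sha16 095a9dabe50403a6, 265 l., code-`sorry`-free) with the NAMESPACE KEPT — `Summit.HodgeConjecture.HodgeConjecture.Cruxes.HLiu418.F0P6qTameLevelQuotient` — MINUS its §1: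
the head `quot_holds` (1 declaration) keeps its fully-qualified name UNCHANGED, while the six §1 theorems the workfile had re-pasted from A-p03 (g27)'s ★ organ
`Literature/AlgebraicGeometry/ShimuraVarieties/UnitaryShimuraCurveLevelQuotientAction.lean` (p844619) — `exists_levelQuotientAction`,
`hom_eq_recordHeckeTranslateGS_of_isHeckeTranslate`, `isGeometricQuotient_of_isSepQuotient`, `exists_levelQuotientAction_isGeometricQuotient`, `hσ_of_genericFibre_square`,
`exists_levelQuotientAction_of_model` — are NOT re-filed (gate `dedup.landed`, dry-run of v1 9eaff457 by LA7-p02 (g3) 10:28Z): they are CITED BY NAME from the ★ organ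
(`RecordSystemGS.…` ∕ `IntegralModel.hσ_of_genericFibre_square`).  The paste existed only because the letter then lived over the `Lines/` Body, which re-declared
`…AppendixC.recordHeckeTranslateGS` and so could not be imported next to the organ; behind the gate the letter's Body is ★ `Theorems.F0D6CmCurveBody*`, which imports
★ `RecordCurveSec42Datum` by name, so organ and letter now read the SAME `recordHeckeTranslateGS` and the six statements coincide.  The one tree reader of a dropped
name (`Lines/F0_P6a_ModuliDatum.lean` l. 560, `…F0P6qTameLevelQuotient.exists_levelQuotientAction_isGeometricQuotient`) is served by the later `Lines/` SHIM (alias to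
`RecordSystemGS.exists_levelQuotientAction_isGeometricQuotient`), not by this file.  Otherwise only this module docstring is re-headed and the `Lines` import is switched to
its ★ re-homed twin (`F0D9opRoad2Mod` → `Theorems.F0D9opRoad2Mod`).  Why a re-home: a `Theorems/` file cannot import a `Lines/` workfile (F0P6-ref1 o-6), and closing
stmt-HodgeConjecture-24832 `--as proved --by <Theorems decl>` at rung 0 needs the sorry-free Lines chain behind the gate (RE-HOME MAP v1.1, LA7-plan (g4),
2026-09-02; director g27 s1336 (R1)–(R3)).    Lines importers of the original: `F0_D9opRoad2`, `F0_P6a_ModuliDatum`.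
After this file is ★ the Lines workfile is meant to become a one-import SHIM of it (a `Lines/` write, batched per cone on the LEAD's word), so no
environment ever holds two copies (NO-CROSS-IMPORT rule, «M-72» (3)).  It asserts nothing beyond what the workfile already proves.

## Original module docstring (verbatim)
# Sub-line «M-Q» `Lines/F0_P6q_TameLevelQuotient.lean` — `quot_holds : F0D9opRoad2.RecordTameLevelQuotientModel`, PROVED (0 sorry)

Cell `hodgecm-mathlib` (D-0151), programme P6 («MOD»), crux HLiu418 (`stmt-HodgeConjecture-24832`); sub-line of `Cruxes/HLiu418/Lines/F0_D9opRoad2`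
ED. 6 (door P″, LEAD F0P6-plan (g0) ruling M-1), BY WRITE (no registry: it carries NO stub).  The parent's registered-to-be stub
`stub_MODquot : RecordTameLevelQuotientModel` (module ★ `Lines/F0D9opRoad2Mod`) is closed here BY NAME, sorry-free: **`theorem quot_holds :
RecordTameLevelQuotientModel`** (§2); the parent folds `stub_MODquot := F0P6qTameLevelQuotient.quot_holds` at its next edition (a `Theorems/` home is
impossible: Theorems files may not import `Cruxes/…/Lines` modules, where the letter lives).  Hand M-Q = A-p14 (g30) (head + integral half) with
A-p03 (g27) (generic-fibre half), rulings M-1 (F) ∕ M-1a (4); the two generic organs are ★ Literature (`--supports stmt-HodgeConjecture-24832`).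

## The letter and its proof in two halves

`RecordTameLevelQuotientModel`: for a record datum `(F, ι₁, J⋆, K₀, S, hU7ₛ)` with `J⋆` hermitian invertible, small levels `Kc ≤ K` with `Kc`
normalised by `K`, a finite group `G` with `φ : K ↠ G` of kernel `Kc` and ORDER INVERTIBLE in `𝒪_{F,(w)}`, a smooth proper model `𝒮c` of
`M⋆_{Kc}` over `𝒪_{F,(w)}` (relative dimension `1`) with an action `ρ` of `G` over `Spec 𝒪_{F,(w)}` whose generic fibre is the record translate
`k ↦ T_{k⁻¹}` and with every point in a `G`-stable affine open — THERE IS a smooth proper model `𝒮` of `M⋆_K` and a model morphism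
`ū : 𝒮c ⟶ 𝒮` whose generic fibre is the transition `u_{Kc→K} = S.M.map (homOfLE hKcK)`.
* §1 GENERIC-FIBRE HALF — A-p03 (g27)'s ★ organ `Literature/AlgebraicGeometry/ShimuraVarieties/UnitaryShimuraCurveLevelQuotientAction.lean`
  (p844619), IMPORTED (in the workfile: re-homed over the line Body; here: cited by name — see above): the translates descend through `φ` to `σ : G →* Aut_F(M⋆_{Kc})`, compatible with `ρ` through `𝒮c.genericIso` (the
  `hσ`-square), and `u_{Kc→K}` is a GEOMETRIC QUOTIENT of `M⋆_{Kc}` by `G` ([Deligne1979ShimuraVarieties] 2.7.1 (b)–(c); [MumfordAV1970]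
  §7).  WHY RE-HOMED (source text identical up to one import and the namespace): the ★ organ imports
  `Literature/…/Liu2021/AppendixC/RecordCurveSec42Datum` for `recordHeckeTranslateGS`, while the letter lives over the line Body
  `Cruxes/HLiu418/Lines/D6CmCurveBody`, which declares THE SAME fully-qualified names (`…AppendixC.recordHeckeTranslateGS`, `restrictIsoOfLe`,
  …) by paste; Lean refuses to import both («environment already contains `…restrictIsoOfLe`»), so no file can cite the ★ organ BY NAME next
  to the letter.  §1 is therefore the ★ organ's six theorems with `RecordCurveSec42Datum` replaced by the Body (statements byte-identical,
  reading the Body's `recordHeckeTranslateGS` — the one the letter means), in this file's namespace; credit A-p03 (g27).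
* §2 INTEGRAL HALF + HEAD — ★ `IntegralModel.exists_tameQuotient_isSmoothProper_one` (A-p14 (g30),
  `Literature/AlgebraicGeometry/Motives/IntegralModelTameQuotientSmoothProper.lean`): the tame quotient `𝒮c/G` is a smooth proper integral
  model of `M⋆_K` with `ū_F = u_{Kc→K}` (SGA 1 V 1.9∕1.5 via ★ `IntegralModel.exists_quotient_of_isProper`; Katz–Mazur A7.1 via ★
  `ActionOver.smoothOfRelativeDimension_one_and_isProper_gluedDesc_of_isUnit_card`, residue fields of `Spec 𝒪_{F,(w)}` perfect); `M⋆_K` is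
  separated, being projective by the record's (F1) (★ `IsProjectiveOver.isProper`).
HC_CM is proved only modulo the 2 remaining named inputs (hLiu418 24832, h413 24833) — behind them the booked printed statements + the MOD package —
until rung 0 closes; this file removes the M-Q piece from the MOD boundary's open set once folded (ED. 7); no books row changes here.
-/

set_option autoImplicit false
-- the mandated namespace repeats `HodgeConjecture.HodgeConjecture` (D-0017), as in the parent line
set_option linter.dupNamespace false

noncomputable section

-- `(ρ.aut g).hom` with `ρ.aut g : Aut _` is only type-correct after unfolding `Aut` (as in ★ `RelativeSpec/FiniteGroupQuotientGluing`,
-- ★ `Motives/IntegralModelOfFiniteQuotient`, ★ `UnitaryShimuraCurveLevelQuotientAction`).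
set_option backward.isDefEq.respectTransparency false

open CategoryTheory CategoryTheory.Limits AlgebraicGeometry NumberField IsDedekindDomain
open scoped Matrix
open Literature.NumberTheory.Automorphic Literature.NumberTheory.Automorphic.UnitaryGroup
open Literature.AlgebraicGeometry.ShimuraVarieties.UnitaryCanonicalModel
open Literature.NumberTheory.Automorphic.Liu2021.AppendixC
open Literature.AlgebraicGeometry.RelativeSpec (ActionOver)
open Literature.AlgebraicGeometry.Motives (IntegralModel SchemeOver IsSepQuotient)
open Literature.NumberTheory.EllipticCurves (genericFibre)
open Summit.HodgeConjecture.HodgeConjecture.Cruxes.HLiu418.F0D9opRoad2 (RecordTameLevelQuotientModel)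

namespace Summit.HodgeConjecture.HodgeConjecture.Cruxes.HLiu418.F0P6qTameLevelQuotient

/-! ## §1 The generic-fibre half — ★ `Literature.AlgebraicGeometry.ShimuraVarieties.UnitaryCanonicalModel.RecordSystemGS.exists_levelQuotientAction_of_model` (A-p03 (g27), p844619), imported; nothing declared here -/

/-! ## §2 The head: integral half + assembly (A-p14 (g30)) -/

section Head

/-- **`quot_holds : RecordTameLevelQuotientModel`** — the tame level-quotient letter of the MOD boundary (the parent's ED. 6 stub
`stub_MODquot`) PROVED: at the letter's data, A-p03's ★ `RecordSystemGS.exists_levelQuotientAction_of_model` (imported by name) supplies the descended action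
`σ` of `G = K/Kc` on `M⋆_{Kc}`, its compatibility with `ρ` through `𝒮c.genericIso` and the geometric quotient `u_{Kc→K} : M⋆_{Kc} → M⋆_K`;
`M⋆_K` is separated (projective, record (F1), ★ `IsProjectiveOver.isProper`); then ★ `IntegralModel.exists_tameQuotient_isSmoothProper_one`
(SGA 1 V 1.9∕1.5 + Katz–Mazur A7.1 over `𝒪_{F,(w)}`) yields the smooth proper model `𝒮 = 𝒮c/G` of `M⋆_K`, `ū : 𝒮c ⟶ 𝒮` and the
generic square `ū_F ≫ 𝒮.genericIso' = 𝒮c.genericIso' ≫ u_{Kc→K}`. [cite: KatzMazur1985, A7.1] -/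
theorem quot_holds : RecordTameLevelQuotientModel := by
  intro F _ _ _ _ ι₁ Jstar K₀ S hU7ₛ hJ hJu K w Kc hKcK hn G _ _ φ hφ hφker hcard 𝒮c h𝒮c ρ hcov hρ
  obtain ⟨σ, hσ, hq, -⟩ := S.exists_levelQuotientAction_of_model hU7ₛ hJ hJu hKcK hn G φ hφ hφker w 𝒮c ρ hρ
  haveI : IsProper (S.M.obj K).hom := (S.projective K).isProper
  obtain ⟨𝒮, h𝒮, ū, -, -, hsq⟩ :=
    𝒮c.exists_tameQuotient_isSmoothProper_one h𝒮c ρ hcov hcard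
      (⟨((Over.forget _).mapAut (S.M.obj Kc)).comp σ, fun g => Over.w (σ g).hom⟩ : ActionOver (S.M.obj Kc).hom G)
      hσ (S.M.map (homOfLE hKcK)) hq
  exact ⟨𝒮, h𝒮, ū, hsq⟩

end Head

end Summit.HodgeConjecture.HodgeConjecture.Cruxes.HLiu418.F0P6qTameLevelQuotient

end
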